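import Literature.AlgebraicGeometry.Pohlmann1968.CMFieldDegreeLeSixAllPowersHodgeConjecture
import HarnessLib

/-!
# Non-primitive CM types of CM fields of degree `≤ 12`: every realisation (a NON-SIMPLE CM abelian variety of dimension `≤ 6`) has
# `B•(Aⁿ) ⊗ ℂ = D•(Aⁿ) ⊗ ℂ` and satisfies the Hodge conjecture with all its powers

Layer `Literature/AlgebraicGeometry/Pohlmann1968`, namespace `Literature.AlgebraicGeometry.Pohlmann1968`; lane `lit-hodgefound` (Track 2
foundations library), prover seat `lit-hodgefound-p10`, generation 33, row «A2-26(hl)» (self-proposed 2026-08-28).  Theorems only; no `def`, no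
instance, no named fact (net Literature debt 0).  Sequel of `CMFieldDegreeLeSixAllPowersHodgeConjecture`.

`K` a CM field with `[K : ℚ] ≤ 12`, `Φ` a NON-primitive CM type of `K`, `A ⊨ (K; Φ)` (so `A` is not simple: `A ∼ B^h`, `h ≥ 2`).  The primitive
sub-pair `(K₁, Φ₁)` has `[K : K₁] ≥ 2` (`two_le_finrank_of_not_isPrimitive`), hence `[K₁ : ℚ] ≤ 6`, so `Φ₁` is nondegenerate
(`isNondegenerate_of_isPrimitive_of_finrank_le_six`) and Hazama's criterion (`IsNondegenerate.hodgeClassSpan_pow_eq_divisorClassesSpan_inducedCMType`)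
gives `B•(Aⁿ) ⊗ ℂ = D•(Aⁿ) ⊗ ℂ` for all `n`.  In degree `8, 10, 12` the PRIMITIVE types can be degenerate (Pohlmann–Shioda `ℚ(ζ₃₁)`-type
examples start at degree `12` for abelian fields; degree `8`: Dodson's `ℤ₂ × A₄ ∕ ℤ₂ × S₄` fields) — not treated here; the cyclotomic degree-`8`
primitive types are the generation's `CyclotomicCMTypesDegreeEightHodgeConjecture`.

* **`hodgeClassSpan_pow_eq_divisorClassesSpan_of_not_isPrimitive_of_finrank_le_twelve`**,
  **`hodgeConjectureFor_pow_of_not_isPrimitive_of_finrank_le_twelve`**, `not_exists_exceptional_pow_of_not_isPrimitive_of_finrank_le_twelve`,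
  and the «not simple» spelling **`hodgeConjectureFor_pow_of_not_isSimple_of_finrank_le_twelve`** (`A` a non-simple realisation).

## References

* [Gordon1999HodgeAVSurvey] B. B. Gordon, *A survey of the Hodge conjecture for abelian varieties* (1999), Thm. 6.4, §9.3.
* [Hazama2003CyclicCM] F. Hazama, J. Math. Sci. Univ. Tokyo 10 (2003), p. 582.
* [Streng2010] M. Streng, PhD thesis, Leiden (2010), Ch. I Lemma 3.5.
* [MoonenZarhin1999LowDim] B. Moonen, Yu. Zarhin, Math. Ann. 315 (1999), Thm. 0.1.
* [Shimura1998] G. Shimura (1998), §6.2 Thm. 3, §8.2 Prop. 26.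
-/

noncomputable section

open scoped Classical NumberField
open NumberField Module CategoryTheory CategoryTheory.Limits

namespace Literature.AlgebraicGeometry.Pohlmann1968

-- `open scoped`: the tree's action of `Aut(ℂ)` on `Hom(K, ℂ)` by composition (`ringEquivCompAction`) is a scoped instance
open scoped Literature.NumberTheory.ComplexMultiplication
open Literature.AlgebraicGeometry.Motives (CMType AbelianVariety)
open Literature.AlgebraicGeometry.HodgeTheory
open Literature.AlgebraicGeometry.VanGeemen1994 (hodgeClassSpan)
open Literature.Barriers.HodgeConjecture (divisorClassesSpan)
open Literature.NumberTheory.ComplexMultiplication (IsPrimitive inducedCMType exists_primitive_inducedCMType_eq_of_isCMField)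
open Literature.AlgebraicGeometry.ComplexMultiplication (IsCMTypeRealisation isPrimitive_ringEquiv_complex_iff isSimple_iff_isPrimitive)

variable {K : Type} [Field K] [NumberField K] [IsCMField K]
  {A : AbelianVariety ℂ} {ι : 𝓞 K →+* End A} {θ : K →+* Module.End ℂ (complexBetti A.X 1)}

/-- **`Bᵐ(Aⁿ) ⊗ ℂ = Dᵐ(Aⁿ) ⊗ ℂ` FOR ALL `n, m`, FOR EVERY NON-PRIMITIVE CM TYPE OF A CM FIELD OF DEGREE `≤ 12` AND EVERY REALISATION** (the
primitive sub-pair has degree `≤ 6`, is nondegenerate; Hazama's criterion). [cite: Gordon1999HodgeAVSurvey, Thm. 6.4 and §9.3]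
[cite: Hazama2003CyclicCM, p. 582] [cite: Streng2010, Ch. I Lemma 3.5] -/
theorem hodgeClassSpan_pow_eq_divisorClassesSpan_of_not_isPrimitive_of_finrank_le_twelve (hK : Module.finrank ℚ K ≤ 12) (Φ : CMType K)
    (φ₀ : K →+* ℂ) (hΦ : ¬ IsPrimitive (ℂ ≃+* ℂ) Φ.1 φ₀) (hA : IsCMTypeRealisation Φ A ι θ) (n m : ℕ) :
    hodgeClassSpan (⨁ fun _ : Fin n => A).dim (⨁ fun _ : Fin n => A).X m =
      divisorClassesSpan (⨁ fun _ : Fin n => A).X (⨁ fun _ : Fin n => A).dim m := by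
  obtain ⟨K₁, Φ₁, hCM, h₁, hp₁, hmin⟩ := exists_primitive_inducedCMType_eq_of_isCMField Φ
  haveI := hCM
  have h2 := two_le_finrank_of_not_isPrimitive hmin φ₀ hΦ
  have hmul : Module.finrank ℚ K₁ * Module.finrank K₁ K = Module.finrank ℚ K := Module.finrank_mul_finrank ℚ K₁ K
  have hK₁ : Module.finrank ℚ K₁ ≤ 6 := by
    have h : Module.finrank ℚ K₁ * 2 ≤ Module.finrank ℚ K := hmul ▸ Nat.mul_le_mul_left _ h2
    omega
  obtain ⟨s₀⟩ : Nonempty (K₁ →+* ℂ) := inferInstance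
  have hp : IsPrimitive (ℂ ≃+* ℂ) Φ₁.1 s₀ := (isPrimitive_ringEquiv_complex_iff Φ₁ s₀).2 hp₁
  exact (isNondegenerate_of_isPrimitive_of_finrank_le_six Φ₁ hK₁ s₀ hp).hodgeClassSpan_pow_eq_divisorClassesSpan_inducedCMType h₁ hA n m

/-- `Bᵐ ⊗ ℂ = Dᵐ ⊗ ℂ` for all `m` on an abelian variety gives the Hodge conjecture for it (Lefschetz `(1,1)`, cup products, tree theorems).
[cite: Gordon1999HodgeAVSurvey, §9.3] -/
private theorem hodgeConjectureFor_of_forall_hodgeClassSpan_eq₄₇ (B : AbelianVariety ℂ)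
    (h : ∀ m : ℕ, hodgeClassSpan B.dim B.X m = divisorClassesSpan B.X B.dim m) : HodgeConjectureFor B.dim B.X :=
  ⟨nonempty_hodgeModel_holds (Motives.AbelianVariety.isSmoothProjective_holds (A := B)),
    fun m _ hc hmm ↦ AbelianVariety.divisorClassesSpan_le_algebraicClasses B
      (fun b hb hb' ↦ lefschetzOneOne_rational_holds (Motives.AbelianVariety.isSmoothProjective_holds (A := B)) b hb hb') m
      ((h m) ▸ Submodule.subset_span ⟨hc, hmm⟩)⟩

/-- **THE HODGE CONJECTURE FOR EVERY POWER OF EVERY REALISATION OF A NON-PRIMITIVE CM TYPE OF A CM FIELD OF DEGREE `≤ 12`.**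
[cite: Gordon1999HodgeAVSurvey, Thm. 6.4 and §9.3] [cite: Hazama2003CyclicCM, p. 582] [cite: MoonenZarhin1999LowDim, Thm. 0.1] -/
theorem hodgeConjectureFor_pow_of_not_isPrimitive_of_finrank_le_twelve (hK : Module.finrank ℚ K ≤ 12) (Φ : CMType K) (φ₀ : K →+* ℂ)
    (hΦ : ¬ IsPrimitive (ℂ ≃+* ℂ) Φ.1 φ₀) (hA : IsCMTypeRealisation Φ A ι θ) (n : ℕ) :
    HodgeConjectureFor (⨁ fun _ : Fin n => A).dim (⨁ fun _ : Fin n => A).X :=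
  hodgeConjectureFor_of_forall_hodgeClassSpan_eq₄₇ _
    (fun m ↦ hodgeClassSpan_pow_eq_divisorClassesSpan_of_not_isPrimitive_of_finrank_le_twelve hK Φ φ₀ hΦ hA n m)

/-- No power of such an `A` carries an exceptional Hodge class. [cite: Gordon1999HodgeAVSurvey, Thm. 6.4] -/
theorem not_exists_exceptional_pow_of_not_isPrimitive_of_finrank_le_twelve (hK : Module.finrank ℚ K ≤ 12) (Φ : CMType K)
    (φ₀ : K →+* ℂ) (hΦ : ¬ IsPrimitive (ℂ ≃+* ℂ) Φ.1 φ₀) (hA : IsCMTypeRealisation Φ A ι θ) (n m : ℕ) :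
    ¬ ∃ c : complexBetti (⨁ fun _ : Fin n => A).X (2 * m), IsRationalClass c ∧
        IsOfHodgeType (⨁ fun _ : Fin n => A).dim (⨁ fun _ : Fin n => A).X (2 * m) m m c ∧
        c ∉ divisorClassesSpan (⨁ fun _ : Fin n => A).X (⨁ fun _ : Fin n => A).dim m := by
  rintro ⟨c, hcQ, hcH, hcD⟩
  exact hcD ((hodgeClassSpan_pow_eq_divisorClassesSpan_of_not_isPrimitive_of_finrank_le_twelve hK Φ φ₀ hΦ hA n m) ▸
    Submodule.subset_span ⟨hcQ, hcH⟩)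

/-- **THE HODGE CONJECTURE FOR EVERY POWER OF EVERY NON-SIMPLE ABELIAN VARIETY WITH COMPLEX MULTIPLICATION BY A CM FIELD OF DEGREE `≤ 12`**
(through a CM type: non-simple ⟺ the type is not primitive; abelian varieties of dimension `≤ 6` isogenous to `B^h`, `h ≥ 2`, `B` simple of CM type).
[cite: Shimura1998, §8.2 Prop. 26, §6.2 Thm. 3] [cite: Gordon1999HodgeAVSurvey, Thm. 6.4 and §9.3] [cite: MoonenZarhin1999LowDim, Thm. 0.1] -/
theorem hodgeConjectureFor_pow_of_not_isSimple_of_finrank_le_twelve (hK : Module.finrank ℚ K ≤ 12) (Φ : CMType K)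
    (hA : IsCMTypeRealisation Φ A ι θ) (hns : ¬ A.IsSimple) (n : ℕ) :
    HodgeConjectureFor (⨁ fun _ : Fin n => A).dim (⨁ fun _ : Fin n => A).X := by
  obtain ⟨φ₀⟩ : Nonempty (K →+* ℂ) := inferInstance
  exact hodgeConjectureFor_pow_of_not_isPrimitive_of_finrank_le_twelve hK Φ φ₀
    (fun h ↦ hns ((isSimple_iff_isPrimitive hA φ₀).2 h)) hA n

end Literature.AlgebraicGeometry.Pohlmann1968

end
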